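/-
Copyright: the b2b-balaban T⁴-continuum CRUX team, row NE7b OWNER lineage `t4-ne7b-p1` (gen 125). Project licence.
-/
import Summits.QuantumFields.BalabanUV.T4Continuum.Spine.NE7b.SupZdKernelTorusWindow

/-!
# KERNEL ALGEBRA, IX: ALONG THE TOWER OF TORI THE INVERSES CONVERGE TO THE `ℤ^d` DECAYING INVERSE — for a FAMILY `Tt_k` of symmetric
# kernels on the coarse tori `Site d (3^k)` with UNIFORM floor `γ_t` and decay `C_te^{−κρ}`, uniformly within the row seam `C_se^{−δ_sω_k(y)}` of
# the window readings of ONE symmetric `ℤ^d` kernel `T` (floor `γ_z` on finite supports, decay `C_ze^{−δ_z|b−c|₁}`), and ANY decaying `N` with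
# `TN = 1`: for all `b, b′ ∈ ℤ^d`, `Tt_k⁻¹(σ_k b, σ_k b′) → N(b,b′)` as `k → ∞`, with the explicit bound
# `c₁e^{−δ₁(3^k∕2 − 4 − |b|₁ − |b′|₁)} + 2C″(e^{−(ν′∕2)((3^k−1)∕2 − |b|₁ − |b′|₁)})` beyond the window radius of `b, b′` — (241) at `y = σ_k b`,
# `y′ = σ_k b′` (there `wm σ_k b = b`) and three exponentials tending to zero.  The abstract END of the torus → `ℤ^d` identification; the
# `H + K` road instance (`Tt_k = T^{tor}_{K,k}` from (165)∕(166), `T = T_K`, `N = N_K` from (234), seam (240)) is a substitution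
# (row NE7b, node U5c; (199)∕(241) BY NAME; [folklore])

Cell `pub-balaban`, sub-cell `t4`, spine estimate NE7b (`T4WeightBudget.RelWeightBound`; the cell's OWN estimate — NOT PRINTED in
[Bałaban 1983–89], NOT PROVED).  Crux-route work under `Spine/NE7b/` by the row OWNER (`t4-ne7b-p1` gen 125, file (242)) under FREEZE
(0)'s crux-prover clause; NOTHING of Bałaban's is named as a Lean object, valued or asserted; no `T4Continuum/Support` leaf typed; no `def`,
no notation; zero `sorry`; no road object (pure kernel algebra).  Imports (BY NAME): the OWNER's (241) `…SupZdKernelTorusWindow`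
(`torus_inverse_close`; through it (180) `torusNorm_le_l1`, `inWindow_of_le`, the torus dictionary), Mathlib's `tendsto_pow_atTop_atTop_of_one_lt`,
`Real.tendsto_exp_atBot`, `tendsto_of_tendsto_of_tendsto_of_le_of_le'`.

WHY (located).  (199) §3 turned the window-depth bound into the thermodynamic limit of the linear column's next-scale Hessian at fixed
coarse points; the same bookkeeping on (241)'s bound gives the limit for every family of torus kernels uniformly seam-close to a `ℤ^d`
kernel — in particular (once instantiated) `(T^{tor}_{K,k})⁻¹(σ_k b, σ_k b′) → N_K(b,b′)`: the infinite-volume perturbed next-scale Hessian IS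
the limit of the torus ones.

WHAT IS PROVED ([folklore]): §1 `exp_bound_tendsto_zero` (bookkeeping); §2 THE END **`torus_inverses_tendsto`** (uniform family
hypotheses ⟹ the explicit bound beyond the window radius and the limit); §3 toy.

HONEST (what this is NOT).  Abstract; the road substitution is the sequel; nothing of the covariant propagators of [B4]–[B6]; nothing of
Bałaban's asserted.  BY-NAME EFFECT ON THE WALL: NONE.  NE7b NOT PRINTED ∕ NOT PROVED; spine PROVED 0∕9; rung (B)+1 — the programme's
measures remain FINITE-torus statements; NOT the mass gap, NOT Clay.  HONEST DEPENDENCY: continuum YM on T⁴ ⇐ BetaPertH ∧ nine spine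
estimates (0∕9 proved); BetaPertH ⇐ (D1) ∧ (D4) ∧ CAP+tail; G-an2-4 gates asym, D1 and NE2∕3∕4.
-/

set_option autoImplicit false

noncomputable section

namespace Summit.QuantumFields.BalabanUV.T4Continuum.NE7b.SupZdKernelTorusLimit

open Real Filter Topology
open Literature.MathematicalPhysics.QuantumFieldTheory.Balaban1983to89
open B6QGQLower276 (X)
open Beta (Site siteOf windowMap siteOf_windowMap windowMap_siteOf)
open SupZdPropagatorLimit (torusNorm_le_l1 inWindow_of_le)
open SupZdKernelTorusWindow (torus_inverse_close)

variable {d : ℕ}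

/-! ## §1. Bookkeeping: `Ce^{−a(3^k − B)} → 0` -/

/-- `C·e^{−a(q·3^k − B)} → 0` as `k → ∞` for `a, q > 0`. [folklore] -/
theorem exp_bound_tendsto_zero (C a q B : ℝ) (ha : 0 < a) (hq : 0 < q) :
    Tendsto (fun k : ℕ => C * exp (-(a * (q * ((3 ^ k : ℕ) : ℝ) - B)))) atTop (𝓝 0) := by
  have h3 : Tendsto (fun k : ℕ => ((3 ^ k : ℕ) : ℝ)) atTop atTop :=
    (tendsto_pow_atTop_atTop_of_one_lt (by norm_num : (1 : ℝ) < 3)).congr fun k => by norm_cast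
  have h4 : Tendsto (fun k : ℕ => a * (q * ((3 ^ k : ℕ) : ℝ) - B)) atTop atTop :=
    ((tendsto_atTop_add_const_right atTop (-B) (h3.const_mul_atTop hq)).const_mul_atTop ha).congr fun k => by ring
  have h5 := Real.tendsto_exp_atBot.comp (tendsto_neg_atTop_atBot.comp h4)
  simpa using h5.const_mul C

/-! ## §2. THE END: the limit along the tower -/

/-- **HEADLINE — ALONG THE TOWER THE TORUS INVERSES CONVERGE TO THE `ℤ^d` DECAYING INVERSE.**  With (241)'s letters `c₁ δ₁ c₂ δ₂` (from
`(γ_t, C_t, κ, γ_z, C_z, δ_z, C_s, δ_s, d)`): for EVERY symmetric `ℤ^d` kernel `T` (floor `γ_z`, decay `(C_z, δ_z)`), EVERY decaying right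
inverse `N` (`C_N`, `ν`), and EVERY family `Tt_k` of symmetric torus kernels with the uniform floor `γ_t`, decay `C_te^{−κρ}` and row seam
`C_se^{−δ_sω_k}` against `T∘wm_k`: for all `b, b′ ∈ ℤ^d` and all `k ≥ 2(|b|₁ + |b′|₁) + 1`,
`|Tt_k⁻¹(σ_k b, σ_k b′) − N(b,b′)| ≤ c₁e^{−δ₁(3^k − 4 − |b|₁ − |b′|₁)∕2} + C″·2e^{−(ν′∕2)(3^k∕2 − 1∕2 − |b|₁ − |b′|₁)}` and
`Tt_k⁻¹(σ_k b, σ_k b′) → N(b,b′)`. [folklore] -/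
theorem torus_inverses_tendsto {γt Ct κ γz Cz δz Cs δs : ℝ} (hγt : 0 < γt) (hCt : 0 < Ct) (hκ : 0 < κ) (hγz : 0 < γz)
    (hCz : 0 < Cz) (hδz : 0 < δz) (hCs : 0 < Cs) (hδs : 0 < δs) :
    ∃ c₁ δ₁ c₂ δ₂ : ℝ, 0 < c₁ ∧ 0 < δ₁ ∧ 0 < c₂ ∧ 0 < δ₂ ∧
    ∀ (T N : X d → X d → ℝ) (CN ν : ℝ), 0 ≤ CN → 0 < ν →
      (∀ b c, T b c = T c b) →
      (∀ (S : Finset (X d)) (g : X d → ℝ), (∀ b, b ∉ S → g b = 0) →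
        γz * ∑ b ∈ S, g b ^ 2 ≤ ∑ b ∈ S, g b * ∑ c ∈ S, T b c * g c) →
      (∀ b c, |T b c| ≤ Cz * exp (-(δz * ∑ i, (((b i - c i).natAbs : ℕ) : ℝ)))) →
      (∀ b c, |N b c| ≤ CN * exp (-(ν * ∑ i, (((b i - c i).natAbs : ℕ) : ℝ)))) →
      (∀ b c, ∑' b' : X d, T b b' * N b' c = if b = c then 1 else 0) →
    ∀ (Tt : (k : ℕ) → Site d (3 ^ k) → Site d (3 ^ k) → ℝ), (∀ k y y', Tt k y y' = Tt k y' y) →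
      (∀ (k : ℕ) (g : Site d (3 ^ k) → ℝ), γt * ∑ y, g y ^ 2 ≤ ∑ y, g y * ∑ y', Tt k y y' * g y') →
      (∀ k y y', |Tt k y y'| ≤ Ct * exp (-(κ * ∑ i, (((y i - y' i).valMinAbs.natAbs : ℕ) : ℝ)))) →
      (∀ k y y', |Tt k y y' - T (windowMap d (3 ^ k) y) (windowMap d (3 ^ k) y')|
        ≤ Cs * exp (-(δs * max 0 ((((3 ^ k : ℕ) : ℝ) / 2 - 2 - ∑ i, ((((y i).valMinAbs).natAbs : ℕ) : ℝ)) / 2)))) →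
    ∀ b b' : X d,
      (∀ k : ℕ, 2 * (∑ i, (b i).natAbs + ∑ i, (b' i).natAbs) + 1 ≤ k →
        |(Matrix.of fun y y' : Site d (3 ^ k) => Tt k y y')⁻¹ (siteOf d (3 ^ k) b) (siteOf d (3 ^ k) b') - N b b'|
          ≤ c₁ * exp (-(δ₁ * ((((3 ^ k : ℕ) : ℝ)
              - (4 + ∑ i, (((b i).natAbs : ℕ) : ℝ) + ∑ i, (((b' i).natAbs : ℕ) : ℝ))) / 2)))
          + (max (max c₂ 1) CN) ^ 2 * (2 * (1 - exp (-(min δ₂ ν)))⁻¹) ^ d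
            * (2 * max Cz 1 * (2 * (1 - exp (-(min δ₂ ν / 2)))⁻¹) ^ d
              * (2 * exp (-(min δ₂ ν / 2 * ((1 / 2) * ((3 ^ k : ℕ) : ℝ)
                - (1 / 2 + ∑ i, (((b i).natAbs : ℕ) : ℝ) + ∑ i, (((b' i).natAbs : ℕ) : ℝ)))))))) ∧
      Tendsto (fun k : ℕ => (Matrix.of fun y y' : Site d (3 ^ k) => Tt k y y')⁻¹ (siteOf d (3 ^ k) b) (siteOf d (3 ^ k) b'))
        atTop (𝓝 (N b b')) := by
  classical
  obtain ⟨c₁, δ₁, c₂, δ₂, hc₁, hδ₁, hc₂, hδ₂, H⟩ := torus_inverse_close (d := d) hγt hCt hκ hγz hCz hδz hCs hδs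
  refine ⟨c₁, δ₁, c₂, δ₂, hc₁, hδ₁, hc₂, hδ₂, ?_⟩
  intro T N CN ν hCN hν hTs hTfloor hTd hN hTN Tt hTts hTtfloor hTtd hseam b b'
  have hν' : 0 < min δ₂ ν := lt_min hδ₂ hν
  obtain ⟨Bb, hBb⟩ : ∃ Bb : ℝ, Bb = ∑ i, (((b i).natAbs : ℕ) : ℝ) + ∑ i, (((b' i).natAbs : ℕ) : ℝ) := ⟨_, rfl⟩
  have hBb0 : 0 ≤ Bb := by rw [hBb]; positivity
  have hKν : 0 ≤ (2 * (1 - exp (-(min δ₂ ν)))⁻¹) ^ d :=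
    pow_nonneg (mul_nonneg zero_le_two (inv_nonneg.2 (sub_nonneg.2 (exp_le_one_iff.2 (by linarith))))) d
  have hKν2 : 0 ≤ (2 * (1 - exp (-(min δ₂ ν / 2)))⁻¹) ^ d :=
    pow_nonneg (mul_nonneg zero_le_two (inv_nonneg.2 (sub_nonneg.2 (exp_le_one_iff.2 (by linarith))))) d
  have hA0 : 0 ≤ (max (max c₂ 1) CN) ^ 2 * (2 * (1 - exp (-(min δ₂ ν)))⁻¹) ^ d := mul_nonneg (sq_nonneg _) hKν
  have hB0 : 0 ≤ 2 * max Cz 1 * (2 * (1 - exp (-(min δ₂ ν / 2)))⁻¹) ^ d :=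
    mul_nonneg (mul_nonneg zero_le_two (le_trans zero_le_one (le_max_right _ _))) hKν2
  -- beyond the window radius the representatives are `b, b′`
  have hwin : ∀ k : ℕ, 2 * (∑ i, (b i).natAbs + ∑ i, (b' i).natAbs) + 1 ≤ k → ∀ c' : X d,
      ∑ i, (c' i).natAbs ≤ ∑ i, (b i).natAbs + ∑ i, (b' i).natAbs → windowMap d (3 ^ k) (siteOf d (3 ^ k) c') = c' :=
    fun k hk c' hc' => windowMap_siteOf d (3 ^ k) fun i => by
      have h := inWindow_of_le 0 k c' (by omega) i
      simpa using h
  have hbd : ∀ k : ℕ, 2 * (∑ i, (b i).natAbs + ∑ i, (b' i).natAbs) + 1 ≤ k →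
      |(Matrix.of fun y y' : Site d (3 ^ k) => Tt k y y')⁻¹ (siteOf d (3 ^ k) b) (siteOf d (3 ^ k) b') - N b b'|
        ≤ c₁ * exp (-(δ₁ * ((((3 ^ k : ℕ) : ℝ) - (4 + Bb)) / 2)))
          + (max (max c₂ 1) CN) ^ 2 * (2 * (1 - exp (-(min δ₂ ν)))⁻¹) ^ d
            * (2 * max Cz 1 * (2 * (1 - exp (-(min δ₂ ν / 2)))⁻¹) ^ d
              * (2 * exp (-(min δ₂ ν / 2 * ((1 / 2) * ((3 ^ k : ℕ) : ℝ) - (1 / 2 + Bb)))))) := by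
    intro k hk
    have h := H T N CN ν hCN hν hTs hTfloor hTd hN hTN k (Tt k) (hTts k) (hTtfloor k) (hTtd k) (hseam k)
      (siteOf d (3 ^ k) b) (siteOf d (3 ^ k) b')
    rw [hwin k hk b (by omega), hwin k hk b' (by omega)] at h
    have e1 := le_max_right 0 ((((3 ^ k : ℕ) : ℝ) / 2 - 2 - ∑ i, (((((siteOf d (3 ^ k) b) i).valMinAbs).natAbs : ℕ) : ℝ)) / 2)
    have e2 := le_max_right 0 ((((3 ^ k : ℕ) : ℝ) / 2 - 2 - ∑ i, (((((siteOf d (3 ^ k) b') i).valMinAbs).natAbs : ℕ) : ℝ)) / 2)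
    have e3 := torusNorm_le_l1 (d := d) (3 ^ k) b
    have e4 := torusNorm_le_l1 (d := d) (3 ^ k) b'
    have hb0 : ∑ i, (((b i - (0 : X d) i).natAbs : ℕ) : ℝ) = ∑ i, (((b i).natAbs : ℕ) : ℝ) :=
      Finset.sum_congr rfl fun i _ => by simp
    have hb0' : ∑ i, (((b' i - (0 : X d) i).natAbs : ℕ) : ℝ) = ∑ i, (((b' i).natAbs : ℕ) : ℝ) :=
      Finset.sum_congr rfl fun i _ => by simp
    rw [hb0, hb0', zero_mul, zero_add] at h
    have hS : (0 : ℝ) ≤ ∑ i, (((b i).natAbs : ℕ) : ℝ) := by positivity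
    have hS' : (0 : ℝ) ≤ ∑ i, (((b' i).natAbs : ℕ) : ℝ) := by positivity
    refine h.trans (add_le_add ?_ ?_)
    · refine mul_le_mul_of_nonneg_left (exp_le_exp.2 (neg_le_neg (mul_le_mul_of_nonneg_left ?_ hδ₁.le))) hc₁.le
      rw [hBb]; linarith
    · refine mul_le_mul_of_nonneg_left (mul_le_mul_of_nonneg_left ?_ hB0) hA0
      have f1 : exp (-(min δ₂ ν / 2 * ((((3 ^ k : ℕ) : ℝ) - 1) / 2 - ∑ i, (((b i).natAbs : ℕ) : ℝ))))
          ≤ exp (-(min δ₂ ν / 2 * ((1 / 2) * ((3 ^ k : ℕ) : ℝ) - (1 / 2 + Bb)))) :=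
        exp_le_exp.2 (neg_le_neg (mul_le_mul_of_nonneg_left (by rw [hBb]; linarith) (by linarith)))
      have f2 : exp (-(min δ₂ ν / 2 * ((((3 ^ k : ℕ) : ℝ) - 1) / 2 - ∑ i, (((b' i).natAbs : ℕ) : ℝ))))
          ≤ exp (-(min δ₂ ν / 2 * ((1 / 2) * ((3 ^ k : ℕ) : ℝ) - (1 / 2 + Bb)))) :=
        exp_le_exp.2 (neg_le_neg (mul_le_mul_of_nonneg_left (by rw [hBb]; linarith) (by linarith)))
      linarith
  refine ⟨fun k hk => by simpa only [hBb, add_assoc] using hbd k hk, ?_⟩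
  -- the bound tends to zero
  have hg1 : Tendsto (fun k : ℕ => c₁ * exp (-(δ₁ / 2 * (1 * ((3 ^ k : ℕ) : ℝ) - (4 + Bb))))) atTop (𝓝 0) :=
    exp_bound_tendsto_zero c₁ (δ₁ / 2) 1 (4 + Bb) (by linarith) one_pos
  have hg2 : Tendsto (fun k : ℕ => ((max (max c₂ 1) CN) ^ 2 * (2 * (1 - exp (-(min δ₂ ν)))⁻¹) ^ d
      * (2 * max Cz 1 * (2 * (1 - exp (-(min δ₂ ν / 2)))⁻¹) ^ d) * 2)
      * exp (-(min δ₂ ν / 2 * ((1 / 2) * ((3 ^ k : ℕ) : ℝ) - (1 / 2 + Bb))))) atTop (𝓝 0) :=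
    exp_bound_tendsto_zero _ (min δ₂ ν / 2) (1 / 2) (1 / 2 + Bb) (by linarith) (by norm_num)
  have hg : Tendsto (fun k : ℕ => c₁ * exp (-(δ₁ * ((((3 ^ k : ℕ) : ℝ) - (4 + Bb)) / 2)))
      + (max (max c₂ 1) CN) ^ 2 * (2 * (1 - exp (-(min δ₂ ν)))⁻¹) ^ d
        * (2 * max Cz 1 * (2 * (1 - exp (-(min δ₂ ν / 2)))⁻¹) ^ d
          * (2 * exp (-(min δ₂ ν / 2 * ((1 / 2) * ((3 ^ k : ℕ) : ℝ) - (1 / 2 + Bb))))))) atTop (𝓝 0) := by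
    have h := hg1.add hg2
    rw [add_zero] at h
    refine h.congr fun k => ?_
    have e : δ₁ / 2 * (1 * ((3 ^ k : ℕ) : ℝ) - (4 + Bb)) = δ₁ * ((((3 ^ k : ℕ) : ℝ) - (4 + Bb)) / 2) := by ring
    rw [e]; ring
  -- squeeze
  have hlo : Tendsto (fun k : ℕ => N b b' - (c₁ * exp (-(δ₁ * ((((3 ^ k : ℕ) : ℝ) - (4 + Bb)) / 2)))
      + (max (max c₂ 1) CN) ^ 2 * (2 * (1 - exp (-(min δ₂ ν)))⁻¹) ^ d
        * (2 * max Cz 1 * (2 * (1 - exp (-(min δ₂ ν / 2)))⁻¹) ^ d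
          * (2 * exp (-(min δ₂ ν / 2 * ((1 / 2) * ((3 ^ k : ℕ) : ℝ) - (1 / 2 + Bb)))))))) atTop (𝓝 (N b b')) := by
    have h := tendsto_const_nhds (x := N b b') (f := (atTop : Filter ℕ)) |>.sub hg
    simpa only [sub_zero] using h
  have hhi : Tendsto (fun k : ℕ => N b b' + (c₁ * exp (-(δ₁ * ((((3 ^ k : ℕ) : ℝ) - (4 + Bb)) / 2)))
      + (max (max c₂ 1) CN) ^ 2 * (2 * (1 - exp (-(min δ₂ ν)))⁻¹) ^ d
        * (2 * max Cz 1 * (2 * (1 - exp (-(min δ₂ ν / 2)))⁻¹) ^ d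
          * (2 * exp (-(min δ₂ ν / 2 * ((1 / 2) * ((3 ^ k : ℕ) : ℝ) - (1 / 2 + Bb)))))))) atTop (𝓝 (N b b')) := by
    have h := tendsto_const_nhds (x := N b b') (f := (atTop : Filter ℕ)) |>.add hg
    simpa only [add_zero] using h
  refine tendsto_of_tendsto_of_tendsto_of_le_of_le' hlo hhi
    (Filter.eventually_atTop.2 ⟨2 * (∑ i, (b i).natAbs + ∑ i, (b' i).natAbs) + 1, fun k hk => ?_⟩)
    (Filter.eventually_atTop.2 ⟨2 * (∑ i, (b i).natAbs + ∑ i, (b' i).natAbs) + 1, fun k hk => ?_⟩)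
  · have h := (abs_le.1 (hbd k hk)).1; linarith
  · have h := (abs_le.1 (hbd k hk)).2; linarith

/-! ## §3. Toy -/

/-- Toy (`d = 1`): the letters exist for unit constants. -/
example : ∃ c₁ δ₁ c₂ δ₂ : ℝ, 0 < c₁ ∧ 0 < δ₁ ∧ 0 < c₂ ∧ 0 < δ₂ :=
  let ⟨c₁, δ₁, c₂, δ₂, h1, h2, h3, h4, _⟩ := torus_inverses_tendsto (d := 1) (γt := 1) (Ct := 1) (κ := 1) (γz := 1) (Cz := 1) (δz := 1)
    (Cs := 1) (δs := 1) one_pos one_pos one_pos one_pos one_pos one_pos one_pos one_pos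
  ⟨c₁, δ₁, c₂, δ₂, h1, h2, h3, h4⟩

end Summit.QuantumFields.BalabanUV.T4Continuum.NE7b.SupZdKernelTorusLimit
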